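import Summits.Schanuel.Schanuel.Theorems.ZilberEacGraphCurveEscapePolyLemmas
import HarnessLib

/-!
# Non-split surfaces over a graph base, III: exact roots of the logarithmically corrected root
# equation `R(z) - μ log z = 2πi N + c₀`

HONEST FRAMING.  Cell `pub-schanuel` (Zilber's Exponential-Algebraic Closedness, case ladder;
host summit Schanuel), seat 2, gen 17.  For an UNBALANCED lower-left edge of the fibre polynomial
`P(x; y₀, y₁)` (a single monomial of top `x`-degree on the edge) the Newton-polygon escape of
gen 16 must balance the edge monomials at `e^{R₀(z)} ≍ z^{μ}` (`μ ≠ 0` the slope of the upper hull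
of the edge points `(m₂ - (m_b)₂, m₀)`), i.e. along exact roots of the corrected equation
`R(z) - μ L = 2πi N + c₀` with `e^{L} = z`.  This file supplies those roots (the contraction step
of `Literature.ModelTheory.Zilber.exists_alRoot` with an ANALYTIC target in place of the constant
`c₀`; the logarithm along the local ray `z₁ e^{ζ/d}` is the explicit analytic branch
`log z₁ + ζ/d`, so no branch cut is met), the size hypothesis for all large stages, and a
logarithm-ratio bound on unit discs.  Engine: `ZilberEacGraphSurfaceEscapeLog`.  NOT Schanuel's
conjecture (neither used nor implied; EAC ⇏ SC); `EC(3,2)` stays OPEN; the density theorems built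
on this are instances of Mantova–Masser's OPEN question (PLMS 2024, §1 p. 5).
-/

noncomputable section

open Filter Topology Metric Set Complex Polynomial
open Literature.ModelTheory.Zilber

set_option linter.dupNamespace false

namespace Summit.Schanuel.Schanuel.Theorems

/-! ## Part A. The contraction step with an analytic target -/

/-- **An exact root of `r(z) = T + ψ` on the ray, analytic target.**  If `a z₁^d = T ≠ 0`, `ψ` is
holomorphic on the unit disc and `‖ℓ(z₁ e^{ζ/d}) - ψ(ζ)‖ ≤ ‖T‖/32` for `‖ζ‖ < 1` (`ℓ` the
lower-order part of `r`), then `r(z₁ e^{ζ/d}) = T + ψ(ζ)` for some `‖ζ‖ ≤ 1/2`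
(solve `e^{ζ} = 1 - (ℓ(z) - ψ(ζ))/T` by `exists_exp_eq_one_sub_of_small`). (new) -/
theorem exists_polyRoot_mul_exp_fun (r : Polynomial ℂ) (hd : 0 < r.natDegree) (z₁ T : ℂ)
    (ψ : ℂ → ℂ) (hψ : DifferentiableOn ℂ ψ (Metric.ball 0 1))
    (hT : r.leadingCoeff * z₁ ^ r.natDegree = T) (hT0 : T ≠ 0)
    (hsmall : ∀ ζ : ℂ, ‖ζ‖ < 1 →
      ‖r.eraseLead.eval (z₁ * exp (ζ / r.natDegree)) - ψ ζ‖ ≤ ‖T‖ / 32) :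
    ∃ ζ : ℂ, ‖ζ‖ ≤ 1 / 2 ∧ r.eval (z₁ * exp (ζ / r.natDegree)) = T + ψ ζ := by
  have hd0 : ((r.natDegree : ℕ) : ℂ) ≠ 0 := Nat.cast_ne_zero.mpr hd.ne'
  set P : ℂ → ℂ := fun ζ => (r.eraseLead.eval (z₁ * exp (ζ / r.natDegree)) - ψ ζ) / T with hP
  have hPd : DifferentiableOn ℂ P (Metric.ball 0 1) := by
    have h1 : Differentiable ℂ fun ζ : ℂ => z₁ * exp (ζ / r.natDegree) :=
      (differentiable_const _).mul ((differentiable_id.div_const _).cexp)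
    exact ((((Polynomial.differentiable _).comp h1).differentiableOn).sub hψ).div_const _
  have hPb : ∀ ζ ∈ Metric.ball (0 : ℂ) 1, ‖P ζ‖ ≤ 1 / 32 := by
    intro ζ hζ
    rw [Metric.mem_ball, dist_zero_right] at hζ
    have h := hsmall ζ hζ
    show ‖(r.eraseLead.eval (z₁ * exp (ζ / r.natDegree)) - ψ ζ) / T‖ ≤ 1 / 32
    rw [norm_div, div_le_iff₀ (norm_pos_iff.mpr hT0)]
    linarith
  obtain ⟨ζ, hζ, hexp⟩ := exists_exp_eq_one_sub_of_small 0 Complex.exp_zero P hPd hPb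
  rw [sub_zero] at hζ
  refine ⟨ζ, hζ, ?_⟩
  have hpow : (z₁ * exp (ζ / r.natDegree)) ^ r.natDegree = z₁ ^ r.natDegree * exp ζ := by
    rw [mul_pow, ← Complex.exp_nat_mul, mul_div_cancel₀ _ hd0]
  rw [eval_eq_eraseLead_add, hpow, ← mul_assoc, hT, hexp]
  show r.eraseLead.eval (z₁ * exp (ζ / r.natDegree)) +
      T * (1 - (r.eraseLead.eval (z₁ * exp (ζ / r.natDegree)) - ψ ζ) / T) = T + ψ ζ
  field_simp
  ring

/-- `‖log z‖ ≤ log ‖z‖ + π` for `‖z‖ ≥ 1`. [folklore] -/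
theorem norm_log_le_of_one_le {z : ℂ} (hz : 1 ≤ ‖z‖) :
    ‖Complex.log z‖ ≤ Real.log ‖z‖ + Real.pi := by
  have h1 := Complex.norm_le_abs_re_add_abs_im (Complex.log z)
  rw [Complex.log_re, Complex.log_im, abs_of_nonneg (Real.log_nonneg hz)] at h1
  have h2 := Complex.abs_arg_le_pi z
  linarith

/-! ## Part B. Stage `k`: an exact root of `r(z₀) - μ L = (k+1)^d s · 2πi + c₀`, `e^{L} = z₀` -/

/-- **Stage `k` of the construction with a logarithmic correction.**  `a ω^d = 2πi s`, `s = ±1`,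
`Re ω ≤ -‖ω‖/2`, `d ≥ 2`, `μ ∈ ℝ`: as soon as `(k+1)‖ω‖ ≥ 1` and
`32 (Σ‖ℓᵢ‖ (3‖ω‖+1)^{d-1} + ‖c₀‖ + |μ| (log((k+1)‖ω‖) + 5)) ≤ 2π (k+1)` there are `z₀` and `L` with
`e^{L} = z₀`, **`r(z₀) = (k+1)^d s · 2πi + c₀ + μ L`**, `(k+1)‖ω‖/3 ≤ ‖z₀‖ ≤ 3 (k+1)‖ω‖` and
`Re z₀ ≤ -(3/16)(k+1)‖ω‖` (the analytic target `ψ(ζ) = c₀ + μ (log z₁ + ζ/d)` on the ray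
`z₁ e^{ζ/d}`, `z₁ = (k+1) ω`). (new) -/
theorem exists_alRoot_log (r : Polynomial ℂ) (hd : 2 ≤ r.natDegree) (ω : ℂ) (s : ℤ)
    (hs : s = 1 ∨ s = -1) (hω : r.leadingCoeff * ω ^ r.natDegree = 2 * Real.pi * I * s)
    (hre : ω.re ≤ -(‖ω‖ / 2)) (μ : ℝ) (c₀ : ℂ) (k : ℕ) (hk1 : 1 ≤ ((k : ℝ) + 1) * ‖ω‖)
    (hk : 32 * (coeffNormSum r.eraseLead * (3 * ‖ω‖ + 1) ^ (r.natDegree - 1) + ‖c₀‖ +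
      |μ| * (Real.log (((k : ℝ) + 1) * ‖ω‖) + 5)) ≤ 2 * Real.pi * ((k : ℝ) + 1)) :
    ∃ z₀ L : ℂ, exp L = z₀ ∧
      r.eval z₀ = (((k + 1) ^ r.natDegree * s : ℤ) : ℂ) * (2 * Real.pi * I) + c₀ + μ * L ∧
      ‖z₀‖ ≤ 3 * (((k : ℝ) + 1) * ‖ω‖) ∧ ((k : ℝ) + 1) * ‖ω‖ / 3 ≤ ‖z₀‖ ∧
      z₀.re ≤ -(3 / 16) * (((k : ℝ) + 1) * ‖ω‖) := by
  set d : ℕ := r.natDegree with hd_def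
  set a : ℂ := r.leadingCoeff with ha_def
  set ℓ : Polynomial ℂ := r.eraseLead with hℓ_def
  have hd1 : 1 ≤ d := le_trans (by norm_num) hd
  have hdpos : (0 : ℝ) < d := by exact_mod_cast (show 0 < d by omega)
  have hsn : ‖(s : ℂ)‖ = 1 := by rcases hs with rfl | rfl <;> simp
  set z₁ : ℂ := ((k : ℂ) + 1) * ω with hz₁
  have hz₁norm : ‖z₁‖ = ((k : ℝ) + 1) * ‖ω‖ := by rw [hz₁, norm_mul, norm_natCast_add_one]
  have hz₁1 : 1 ≤ ‖z₁‖ := by rw [hz₁norm]; exact hk1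
  have hz₁0 : z₁ ≠ 0 := norm_pos_iff.1 (by linarith)
  set L₁ : ℂ := Complex.log z₁ with hL₁
  have hL₁exp : exp L₁ = z₁ := Complex.exp_log hz₁0
  have hL₁norm : ‖L₁‖ ≤ Real.log (((k : ℝ) + 1) * ‖ω‖) + Real.pi := by
    rw [← hz₁norm]; exact norm_log_le_of_one_le hz₁1
  set T : ℂ := (((k + 1) ^ d * s : ℤ) : ℂ) * (2 * Real.pi * I) with hT_def
  have hT : a * z₁ ^ d = T := by
    have : a * z₁ ^ d = ((k : ℂ) + 1) ^ d * (a * ω ^ d) := by rw [hz₁, mul_pow]; ring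
    rw [this, hω, hT_def]; push_cast; ring
  have hTnorm : ‖T‖ = 2 * Real.pi * ((k : ℝ) + 1) ^ d := by
    rw [← hT, norm_mul, norm_pow, hz₁norm, mul_pow]
    have hsabs : |(s : ℝ)| = 1 := by rcases hs with rfl | rfl <;> simp
    have haω : ‖a‖ * ‖ω‖ ^ d = 2 * Real.pi := by
      rw [← norm_pow, ← norm_mul, hω]
      simp [hsabs, Complex.norm_real, Real.norm_eq_abs, abs_of_pos Real.pi_pos]
    calc ‖a‖ * (((k : ℝ) + 1) ^ d * ‖ω‖ ^ d) = (‖a‖ * ‖ω‖ ^ d) * ((k : ℝ) + 1) ^ d := by ring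
      _ = 2 * Real.pi * ((k : ℝ) + 1) ^ d := by rw [haω]
  have hTpos : 0 < ‖T‖ := by rw [hTnorm]; positivity
  have hT0 : T ≠ 0 := norm_pos_iff.mp hTpos
  -- the analytic target
  set ψ : ℂ → ℂ := fun ζ => c₀ + (μ : ℂ) * (L₁ + ζ / d) with hψ_def
  have hψd : DifferentiableOn ℂ ψ (Metric.ball 0 1) :=
    ((differentiable_const _).add ((differentiable_const _).mul
      ((differentiable_const _).add (differentiable_id.div_const _)))).differentiableOn
  have hψn : ∀ ζ : ℂ, ‖ζ‖ < 1 →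
      ‖ψ ζ‖ ≤ ‖c₀‖ + |μ| * (Real.log (((k : ℝ) + 1) * ‖ω‖) + 5) := by
    intro ζ hζ
    have hx : ‖ζ / (d : ℂ)‖ ≤ 1 := by
      rw [norm_div, Complex.norm_natCast]
      exact (div_le_self (norm_nonneg _) (by exact_mod_cast hd1)).trans hζ.le
    have h1 : ‖L₁ + ζ / d‖ ≤ Real.log (((k : ℝ) + 1) * ‖ω‖) + 5 := by
      have := norm_add_le L₁ (ζ / d)
      have hπ := Real.pi_lt_four
      linarith
    calc ‖ψ ζ‖ ≤ ‖c₀‖ + ‖(μ : ℂ) * (L₁ + ζ / d)‖ := norm_add_le _ _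
      _ = ‖c₀‖ + |μ| * ‖L₁ + ζ / d‖ := by
          rw [norm_mul, Complex.norm_real, Real.norm_eq_abs]
      _ ≤ ‖c₀‖ + |μ| * (Real.log (((k : ℝ) + 1) * ‖ω‖) + 5) := by
          gcongr
  -- smallness of the lower-order part against the target on the disc
  have hsmall : ∀ ζ : ℂ, ‖ζ‖ < 1 → ‖ℓ.eval (z₁ * exp (ζ / d)) - ψ ζ‖ ≤ ‖T‖ / 32 := by
    intro ζ hζ
    have hx : ‖ζ / (d : ℂ)‖ ≤ 1 := by
      rw [norm_div, Complex.norm_natCast]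
      exact (div_le_self (norm_nonneg _) (by exact_mod_cast hd1)).trans hζ.le
    set M : ℝ := ((k : ℝ) + 1) * (3 * ‖ω‖ + 1) with hM
    have hM1 : 1 ≤ M := by
      have h1 : (1 : ℝ) ≤ (k : ℝ) + 1 := by linarith [(Nat.cast_nonneg k : (0 : ℝ) ≤ k)]
      have h2 : (1 : ℝ) ≤ 3 * ‖ω‖ + 1 := by linarith [norm_nonneg ω]
      nlinarith
    have hzM : ‖z₁ * exp (ζ / d)‖ ≤ M := by
      rw [norm_mul, hz₁norm, hM]
      have := norm_exp_le_three hx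
      have hk0 : (0 : ℝ) ≤ (k : ℝ) + 1 := by positivity
      calc ((k : ℝ) + 1) * ‖ω‖ * ‖exp (ζ / d)‖ ≤ ((k : ℝ) + 1) * ‖ω‖ * 3 := by
            exact mul_le_mul_of_nonneg_left this (by positivity)
        _ ≤ ((k : ℝ) + 1) * (3 * ‖ω‖ + 1) := by nlinarith [norm_nonneg ω]
    have hℓdeg : ℓ.natDegree ≤ d - 1 := Polynomial.eraseLead_natDegree_le r
    have h1 : ‖ℓ.eval (z₁ * exp (ζ / d))‖ ≤ coeffNormSum ℓ * M ^ (d - 1) :=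
      norm_eval_le_of_natDegree_le ℓ hM1 hzM hℓdeg
    have hkpow : (1 : ℝ) ≤ ((k : ℝ) + 1) ^ (d - 1) :=
      one_le_pow₀ (by linarith [(Nat.cast_nonneg k : (0 : ℝ) ≤ k)])
    have hψ0 : 0 ≤ ‖c₀‖ + |μ| * (Real.log (((k : ℝ) + 1) * ‖ω‖) + 5) := by
      have := Real.log_nonneg hk1
      positivity
    have h2 : ‖ℓ.eval (z₁ * exp (ζ / d)) - ψ ζ‖ ≤
        (coeffNormSum ℓ * (3 * ‖ω‖ + 1) ^ (d - 1) +
          (‖c₀‖ + |μ| * (Real.log (((k : ℝ) + 1) * ‖ω‖) + 5))) * ((k : ℝ) + 1) ^ (d - 1) := by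
      calc ‖ℓ.eval (z₁ * exp (ζ / d)) - ψ ζ‖
          ≤ ‖ℓ.eval (z₁ * exp (ζ / d))‖ + ‖ψ ζ‖ := norm_sub_le _ _
        _ ≤ coeffNormSum ℓ * M ^ (d - 1) +
              (‖c₀‖ + |μ| * (Real.log (((k : ℝ) + 1) * ‖ω‖) + 5)) * ((k : ℝ) + 1) ^ (d - 1) := by
            refine add_le_add h1 ?_
            exact (hψn ζ hζ).trans (le_mul_of_one_le_right hψ0 hkpow)
        _ = (coeffNormSum ℓ * (3 * ‖ω‖ + 1) ^ (d - 1) +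
              (‖c₀‖ + |μ| * (Real.log (((k : ℝ) + 1) * ‖ω‖) + 5))) * ((k : ℝ) + 1) ^ (d - 1) := by
            rw [hM, mul_pow]; ring
    have h3 : (coeffNormSum ℓ * (3 * ‖ω‖ + 1) ^ (d - 1) +
          (‖c₀‖ + |μ| * (Real.log (((k : ℝ) + 1) * ‖ω‖) + 5))) * ((k : ℝ) + 1) ^ (d - 1) ≤
        ‖T‖ / 32 := by
      rw [hTnorm, le_div_iff₀ (by norm_num : (0 : ℝ) < 32)]
      have hpow : ((k : ℝ) + 1) ^ d = ((k : ℝ) + 1) * ((k : ℝ) + 1) ^ (d - 1) := by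
        rw [← pow_succ', Nat.sub_add_cancel hd1]
      rw [hpow]
      have h0 : (0 : ℝ) ≤ ((k : ℝ) + 1) ^ (d - 1) := by positivity
      have hk' : 32 * (coeffNormSum ℓ * (3 * ‖ω‖ + 1) ^ (d - 1) +
          (‖c₀‖ + |μ| * (Real.log (((k : ℝ) + 1) * ‖ω‖) + 5))) ≤ 2 * Real.pi * ((k : ℝ) + 1) := by
        linarith
      nlinarith
    exact h2.trans h3
  obtain ⟨ζ, hζ, hroot⟩ := exists_polyRoot_mul_exp_fun r (by omega) z₁ T ψ hψd hT hT0 hsmall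
  -- the root, its logarithm and its position
  set x : ℂ := ζ / (d : ℂ) with hx_def
  have hx4 : ‖x‖ ≤ 1 / 4 := by
    rw [hx_def, norm_div, Complex.norm_natCast]
    have hd2 : (2 : ℝ) ≤ d := by exact_mod_cast hd
    calc ‖ζ‖ / (d : ℝ) ≤ (1 / 2) / 2 := div_le_div₀ (by norm_num) hζ (by norm_num) hd2
      _ = 1 / 4 := by norm_num
  have hx1 : ‖x‖ ≤ 1 := hx4.trans (by norm_num)
  refine ⟨z₁ * exp x, L₁ + x, ?_, ?_, ?_, ?_, ?_⟩
  · rw [Complex.exp_add, hL₁exp]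
  · rw [hroot, hψ_def]
    simp only [hx_def]
    ring
  · rw [norm_mul, hz₁norm]
    calc ((k : ℝ) + 1) * ‖ω‖ * ‖exp x‖ ≤ ((k : ℝ) + 1) * ‖ω‖ * 3 :=
          mul_le_mul_of_nonneg_left (norm_exp_le_three hx1) (by positivity)
      _ = 3 * (((k : ℝ) + 1) * ‖ω‖) := by ring
  · rw [norm_mul, hz₁norm]
    calc ((k : ℝ) + 1) * ‖ω‖ / 3 = ((k : ℝ) + 1) * ‖ω‖ * (1 / 3) := by ring
      _ ≤ ((k : ℝ) + 1) * ‖ω‖ * ‖exp x‖ :=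
          mul_le_mul_of_nonneg_left (third_le_norm_exp hx1) (by positivity)
  · have h1 : z₁ * exp x = ((k : ℂ) + 1) * (ω * exp x) := by rw [hz₁]; ring
    rw [h1, re_natCast_add_one_mul]
    have h2 : (ω * exp x).re ≤ ω.re + ‖ω‖ * (5 / 16) := by
      have h3 : ω * exp x = ω + ω * (exp x - 1) := by ring
      rw [h3, Complex.add_re]
      refine add_le_add le_rfl ((re_le_norm _).trans ?_)
      rw [norm_mul]
      exact mul_le_mul_of_nonneg_left (norm_exp_sub_one_le_of_quarter hx4) (norm_nonneg _)
    have hk0 : (0 : ℝ) ≤ (k : ℝ) + 1 := by positivity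
    calc ((k : ℝ) + 1) * (ω * exp x).re ≤ ((k : ℝ) + 1) * (ω.re + ‖ω‖ * (5 / 16)) :=
          mul_le_mul_of_nonneg_left h2 hk0
      _ ≤ ((k : ℝ) + 1) * (-(‖ω‖ / 2) + ‖ω‖ * (5 / 16)) := by
          refine mul_le_mul_of_nonneg_left (add_le_add hre le_rfl) hk0
      _ = -(3 / 16) * (((k : ℝ) + 1) * ‖ω‖) := by ring

/-! ## Part C. The size hypothesis holds at all large stages; a logarithm-ratio bound -/

/-- **The size hypothesis of `exists_alRoot_log` for all large `k`** (`log` is `o(k)`):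
eventually `1 ≤ (k+1)ν` and `32 (C + |μ| (log((k+1)ν) + 5)) ≤ 2π (k+1)` (`ν > 0`). [folklore] -/
theorem eventually_alRoot_log_hyp (C μ : ℝ) {ν : ℝ} (hν : 0 < ν) :
    ∀ᶠ k : ℕ in atTop, 1 ≤ ((k : ℝ) + 1) * ν ∧
      32 * (C + |μ| * (Real.log (((k : ℝ) + 1) * ν) + 5)) ≤ 2 * Real.pi * ((k : ℝ) + 1) := by
  have hΛ : Tendsto (fun k : ℕ => ((k : ℝ) + 1) * ν) atTop atTop :=
    (tendsto_natCast_add_atTop 1).atTop_mul_const hν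
  have hπ := Real.pi_gt_three
  -- `log x ≤ c x` eventually, with `32 |μ| c ν ≤ π`
  set c : ℝ := Real.pi / (32 * (|μ| + 1) * ν) with hc
  have hcpos : 0 < c := by positivity
  have hlog : ∀ᶠ x : ℝ in atTop, Real.log x ≤ c * x := by
    have h := Real.isLittleO_log_id_atTop.bound hcpos
    filter_upwards [h, eventually_ge_atTop (1 : ℝ)] with x hx hx1
    simp only [Real.norm_eq_abs, id] at hx
    rw [abs_of_nonneg (by linarith : (0 : ℝ) ≤ x)] at hx
    exact (le_abs_self _).trans hx
  have hev1 : ∀ᶠ k : ℕ in atTop, Real.log (((k : ℝ) + 1) * ν) ≤ c * (((k : ℝ) + 1) * ν) :=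
    hΛ.eventually hlog
  have hev2 : ∀ᶠ k : ℕ in atTop, 1 ≤ ((k : ℝ) + 1) * ν := hΛ.eventually_ge_atTop 1
  have hev3 : ∀ᶠ k : ℕ in atTop, 32 * (C + |μ| * 5) ≤ Real.pi * ((k : ℝ) + 1) :=
    ((tendsto_natCast_add_atTop 1).const_mul_atTop Real.pi_pos).eventually_ge_atTop _
  filter_upwards [hev1, hev2, hev3] with k h1 h2 h3
  refine ⟨h2, ?_⟩
  have hμ0 : 0 ≤ |μ| := abs_nonneg μ
  have h4 : 32 * (|μ| * Real.log (((k : ℝ) + 1) * ν)) ≤ Real.pi * ((k : ℝ) + 1) := by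
    have h5 : 32 * (|μ| * (c * (((k : ℝ) + 1) * ν))) ≤ Real.pi * ((k : ℝ) + 1) := by
      rw [hc]
      have hk0 : (0 : ℝ) ≤ (k : ℝ) + 1 := by positivity
      have e1 : 32 * (|μ| * (Real.pi / (32 * (|μ| + 1) * ν) * (((k : ℝ) + 1) * ν))) =
          (|μ| / (|μ| + 1)) * (Real.pi * ((k : ℝ) + 1)) := by
        field_simp
      rw [e1]
      have e2 : |μ| / (|μ| + 1) ≤ 1 := by
        rw [div_le_one (by positivity)]; linarith
      calc |μ| / (|μ| + 1) * (Real.pi * ((k : ℝ) + 1)) ≤ 1 * (Real.pi * ((k : ℝ) + 1)) :=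
            mul_le_mul_of_nonneg_right e2 (by positivity)
        _ = Real.pi * ((k : ℝ) + 1) := one_mul _
    exact le_trans (by nlinarith [mul_le_mul_of_nonneg_left h1 hμ0]) h5
  nlinarith

/-- **Logarithm ratio on a unit disc far out**: `‖z - z₀‖ ≤ 1`, `‖z₀‖ ≥ 16` ⟹
`|log ‖z‖ - log ‖z₀‖| ≤ 1/8`. [folklore] -/
theorem abs_log_norm_sub_log_norm_le {z z₀ : ℂ} (hz₀ : 16 ≤ ‖z₀‖) (h : ‖z - z₀‖ ≤ 1) :
    |Real.log ‖z‖ - Real.log ‖z₀‖| ≤ 1 / 8 := by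
  have hz₀pos : 0 < ‖z₀‖ := by linarith
  have hzge : ‖z₀‖ - 1 ≤ ‖z‖ := by
    have := norm_sub_norm_le z₀ z
    rw [norm_sub_rev] at this
    linarith
  have hzle : ‖z‖ ≤ ‖z₀‖ + 1 := by
    have := norm_le_insert' z z₀
    linarith
  have hzpos : 0 < ‖z‖ := by linarith
  rw [← Real.log_div hzpos.ne' hz₀pos.ne', abs_le]
  constructor
  · have h1 := Real.one_sub_inv_le_log_of_pos (div_pos hzpos hz₀pos)
    rw [inv_div] at h1
    have h2 : ‖z₀‖ / ‖z‖ ≤ 1 + 1 / 8 := by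
      rw [div_le_iff₀ hzpos]; nlinarith
    linarith
  · have h1 := Real.log_le_sub_one_of_pos (div_pos hzpos hz₀pos)
    have h2 : ‖z‖ / ‖z₀‖ ≤ 1 + 1 / 8 := by
      rw [div_le_iff₀ hz₀pos]; nlinarith
    linarith

end Summit.Schanuel.Schanuel.Theorems
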